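import Literature.NumberTheory.Automorphic.AdelicGLnGlue
import Literature.NumberTheory.Automorphic.RankinSelbergLocalProofs
import HarnessLib

/-!
# The automorphism `g ↦ w₀ ᵗg⁻¹ w₀` of `GL_n` over the adeles: levels, `K_∞`, the height

Topic `NumberTheory/Automorphic`. Proofs-only support file (theorems, no definitions, no named
facts) for the construction of the contragredient of a cuspidal automorphic representation of
`GL_n(𝔸_K)` in the Borel–Jacquet datum model of the tree (`CuspidalContragredient`,
`AutomorphicRepsGL`): the contragredient is realised on the functions `g ↦ φ (w₀ ᵗg⁻¹ w₀)`
(Cogdell 2004, §2, before Thm. 2.1: "`φ̃(g) = φ(g^ι) = φ(w_n g^ι) ∈ V_{π̃}`"; Gelfand–Kazhdan), and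
this file records the elementary behaviour of the automorphism

  `τ(g) = w₀ · ᵗg⁻¹ · w₀`,  `w₀ = weylLong n R` (antidiagonal), `ᵗg⁻¹ = glTransposeInv (Fin n) R g`,

of `GL_n(R)` for a commutative (topological) ring `R` — written throughout, as in
`RankinSelbergLocal` (`tildeFn`) and `GLnGelfandKazhdanInvolution` (`gkInvolution_inv_eq`, fields
only), as the product `weylLong n R * glTransposeInv (Fin n) R g * weylLong n R` of the tree's long
Weyl element and transpose-inverse homomorphism (no new definition is introduced):

* entries `τ(g)_{ij} = (g⁻¹)_{n+1-j, n+1-i}`, `(τ(g)⁻¹)_{ij} = g_{n+1-j, n+1-i}`; `τ` is a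
  multiplicative involution commuting with inversion, with `star`, with every
  `GeneralLinearGroup.map f` and with the embeddings `GLn.ofFinite`, `GLn.ofInfinite`, `GLn.toMixed`
  of `AdelicGLnGlue`; `τ(diag(d)) = diag(k ↦ d_{n+1-k}⁻¹)`;
* `τ` preserves `GL_n(K) ≤ GL_n(𝔸_K)`, `GL_n(𝔸_K^∞)`, the integral level `K^max`, the valued
  congruence subgroups and the principal congruence subgroups `K(𝔫)`, the family of levels
  `finiteLevelsGL`, the maximal compact subgroup `K_∞` (unitary group), and the adelic height
  `‖τ(g)‖ = ‖g‖` (the local heights are symmetric in the entries of `g` and `g⁻¹`).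

## References

* J. W. Cogdell, *Analytic theory of L-functions for GL_n*, in: An Introduction to the Langlands
  Program, Birkhäuser 2004, §2. [CogdellAnalyticTheory2004]
* A. Borel, H. Jacquet, *Automorphic forms and automorphic representations*, PSPM 33.1 (1979),
  §4.1–4.2. [BorelJacquetCorvallis1979]
-/

noncomputable section

open scoped MatrixGroups Matrix NNReal Classical
open NumberField IsDedekindDomain

namespace Literature.NumberTheory.Automorphic

open GaloisRepresentations (glTransposeInv coe_glTransposeInv_apply)

/-! ### `τ(g) = w₀ ᵗg⁻¹ w₀` over a commutative ring -/

section General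

variable {n : ℕ} {R S : Type*} [CommRing R] [TopologicalSpace R] [CommRing S] [TopologicalSpace S]

/-- Entries of `τ(g) = w₀ ᵗg⁻¹ w₀`: `τ(g)_{ij} = (g⁻¹)_{rev j, rev i}`. [folklore] -/
theorem coe_weylLong_mul_glTransposeInv_mul_weylLong_apply (g : GL (Fin n) R) (i j : Fin n) :
    ((weylLong n R * glTransposeInv (Fin n) R g * weylLong n R : GL (Fin n) R) :
      Matrix (Fin n) (Fin n) R) i j = ((g⁻¹ : GL (Fin n) R) : Matrix (Fin n) (Fin n) R) j.rev i.rev := by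
  rw [Units.val_mul, Units.val_mul, weylLong_mul_mul_weylLong_apply, coe_glTransposeInv_apply,
    Matrix.transpose_apply]

/-- `τ` commutes with inversion: `τ(g⁻¹) = τ(g)⁻¹`. [folklore] -/
theorem weylLong_mul_glTransposeInv_mul_weylLong_inv (g : GL (Fin n) R) :
    weylLong n R * glTransposeInv (Fin n) R g⁻¹ * weylLong n R =
      (weylLong n R * glTransposeInv (Fin n) R g * weylLong n R)⁻¹ := by
  rw [mul_inv_rev, mul_inv_rev, weylLong_inv, ← mul_assoc, map_inv]

/-- Entries of `τ(g)⁻¹`: `(τ(g)⁻¹)_{ij} = g_{rev j, rev i}`. [folklore] -/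
theorem coe_inv_weylLong_mul_glTransposeInv_mul_weylLong_apply (g : GL (Fin n) R) (i j : Fin n) :
    (((weylLong n R * glTransposeInv (Fin n) R g * weylLong n R)⁻¹ : GL (Fin n) R) :
      Matrix (Fin n) (Fin n) R) i j = (g : Matrix (Fin n) (Fin n) R) j.rev i.rev := by
  rw [← weylLong_mul_glTransposeInv_mul_weylLong_inv,
    coe_weylLong_mul_glTransposeInv_mul_weylLong_apply, inv_inv]

/-- `τ` is multiplicative (`w₀² = 1`). [folklore] -/
theorem weylLong_mul_glTransposeInv_mul_weylLong_mul (g h : GL (Fin n) R) :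
    weylLong n R * glTransposeInv (Fin n) R (g * h) * weylLong n R =
      (weylLong n R * glTransposeInv (Fin n) R g * weylLong n R) *
        (weylLong n R * glTransposeInv (Fin n) R h * weylLong n R) := by
  rw [map_mul]
  simp only [mul_assoc]
  rw [← mul_assoc (weylLong n R) (weylLong n R), weylLong_mul_self, one_mul]

/-- `τ(1) = 1`. [folklore] -/
theorem weylLong_mul_glTransposeInv_mul_weylLong_one :
    weylLong n R * glTransposeInv (Fin n) R 1 * weylLong n R = 1 := by
  rw [map_one, mul_one, weylLong_mul_self]

/-- `τ` is an involution: `τ(τ(g)) = g`. [folklore] -/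
theorem weylLong_mul_glTransposeInv_mul_weylLong_involutive (g : GL (Fin n) R) :
    weylLong n R * glTransposeInv (Fin n) R
        (weylLong n R * glTransposeInv (Fin n) R g * weylLong n R) * weylLong n R = g := by
  refine Matrix.GeneralLinearGroup.ext fun i j => ?_
  rw [coe_weylLong_mul_glTransposeInv_mul_weylLong_apply,
    coe_inv_weylLong_mul_glTransposeInv_mul_weylLong_apply, Fin.rev_rev, Fin.rev_rev]

/-- `τ` is injective. [folklore] -/
theorem weylLong_mul_glTransposeInv_mul_weylLong_injective :
    Function.Injective fun g : GL (Fin n) R =>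
      weylLong n R * glTransposeInv (Fin n) R g * weylLong n R := fun g h hgh => by
  have := congrArg (fun x => weylLong n R * glTransposeInv (Fin n) R x * weylLong n R) hgh
  simpa only [weylLong_mul_glTransposeInv_mul_weylLong_involutive] using this

/-- `τ` commutes with the functoriality maps `GL_n(f)` of ring homomorphisms `f : R → S`
(all three constituents are defined entrywise). [folklore] -/
theorem map_weylLong_mul_glTransposeInv_mul_weylLong (f : R →+* S) (g : GL (Fin n) R) :
    Matrix.GeneralLinearGroup.map f (weylLong n R * glTransposeInv (Fin n) R g * weylLong n R) =
      weylLong n S * glTransposeInv (Fin n) S (Matrix.GeneralLinearGroup.map f g) * weylLong n S := by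
  refine Matrix.GeneralLinearGroup.ext fun i j => ?_
  rw [Matrix.GeneralLinearGroup.map_apply, coe_weylLong_mul_glTransposeInv_mul_weylLong_apply,
    coe_weylLong_mul_glTransposeInv_mul_weylLong_apply, ← Matrix.GeneralLinearGroup.map_inv,
    Matrix.GeneralLinearGroup.map_apply]

/-- `τ` of a diagonal matrix: `τ(diag(d)) = diag(k ↦ d_{rev k}⁻¹)`. [folklore] -/
theorem weylLong_mul_glTransposeInv_mul_weylLong_glDiagonal (d : Fin n → Rˣ) :
    weylLong n R * glTransposeInv (Fin n) R (glDiagonal n R d) * weylLong n R =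
      glDiagonal n R fun k => (d k.rev)⁻¹ := by
  refine Matrix.GeneralLinearGroup.ext fun i j => ?_
  rw [coe_weylLong_mul_glTransposeInv_mul_weylLong_apply, ← map_inv, coe_glDiagonal, coe_glDiagonal,
    Matrix.diagonal_apply, Matrix.diagonal_apply]
  by_cases h : i = j
  · subst h
    rw [if_pos rfl, if_pos rfl, Pi.inv_apply]
  · rw [if_neg (fun h' => h (Fin.rev_injective h').symm), if_neg h]

/-- `τ` is continuous (for a topological ring `R`). [folklore] -/
theorem continuous_weylLong_mul_glTransposeInv_mul_weylLong [IsTopologicalRing R] :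
    Continuous fun g : GL (Fin n) R => weylLong n R * glTransposeInv (Fin n) R g * weylLong n R :=
  (continuous_const.mul (glTransposeInv (Fin n) R).continuous_toFun).mul continuous_const

/-- `τ` commutes with the entrywise `star` (conjugate-transpose on `GL_n`): `τ(g*) = τ(g)*`. [folklore] -/
theorem weylLong_mul_glTransposeInv_mul_weylLong_star [StarRing R] (g : GL (Fin n) R) :
    weylLong n R * glTransposeInv (Fin n) R (star g) * weylLong n R =
      star (weylLong n R * glTransposeInv (Fin n) R g * weylLong n R) := by
  refine Matrix.GeneralLinearGroup.ext fun i j => ?_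
  rw [coe_weylLong_mul_glTransposeInv_mul_weylLong_apply, Units.coe_star_inv, Units.coe_star,
    Matrix.star_apply, Matrix.star_apply, coe_weylLong_mul_glTransposeInv_mul_weylLong_apply]

end General

/-! ### Valued congruence subgroups -/

section Valued

variable {n : ℕ} {F Γ₀ : Type*} [Field F] [LinearOrderedCommGroupWithZero Γ₀] [Valued F Γ₀]

/-- `τ` preserves the valued congruence subgroups (their defining conditions are symmetric in the
entries of `g` and `g⁻¹`, and `g⁻¹ - 1` has small entries when `g - 1` does). [folklore] -/
theorem weylLong_mul_glTransposeInv_mul_weylLong_mem_valuedCongruenceSubgroup {c : Γ₀}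
    {g : GL (Fin n) F} (hg : g ∈ valuedCongruenceSubgroup (Fin n) c) :
    weylLong n F * glTransposeInv (Fin n) F g * weylLong n F ∈ valuedCongruenceSubgroup (Fin n) c := by
  have hg' := (valuedCongruenceSubgroup (Fin n) c).inv_mem hg
  rw [mem_valuedCongruenceSubgroup_iff] at hg hg' ⊢
  refine ⟨fun i j => ?_, fun i j => ?_, fun i j => ?_⟩
  · rw [coe_weylLong_mul_glTransposeInv_mul_weylLong_apply]
    exact hg.2.1 _ _
  · rw [coe_inv_weylLong_mul_glTransposeInv_mul_weylLong_apply]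
    exact hg.1 _ _
  · have := hg'.2.2 j.rev i.rev
    rw [Matrix.sub_apply] at this ⊢
    rw [coe_weylLong_mul_glTransposeInv_mul_weylLong_apply, Matrix.one_apply]
    rw [Matrix.one_apply] at this
    by_cases h : i = j
    · subst h
      rwa [if_pos rfl] at this ⊢
    · rw [if_neg h]
      rwa [if_neg (fun h' => h (Fin.rev_injective h').symm)] at this

end Valued

/-! ### Over the adeles of a number field -/

section Adelic

variable {n : ℕ} {K : Type} [Field K] [NumberField K]

/-- `τ` commutes with the embedding `GL_n(𝔸_K^∞) → GL_n(𝔸_K)`, `h ↦ (1, h)`. [folklore] -/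
theorem weylLong_mul_glTransposeInv_mul_weylLong_ofFinite (h : GL (Fin n) (FiniteAdeleRing (𝓞 K) K)) :
    weylLong n (AdeleRing (𝓞 K) K) * glTransposeInv (Fin n) (AdeleRing (𝓞 K) K) (GLn.ofFinite n K h) *
        weylLong n (AdeleRing (𝓞 K) K) =
      GLn.ofFinite n K (weylLong n (FiniteAdeleRing (𝓞 K) K) *
        glTransposeInv (Fin n) (FiniteAdeleRing (𝓞 K) K) h * weylLong n (FiniteAdeleRing (𝓞 K) K)) := by
  refine Matrix.GeneralLinearGroup.ext fun i j => ?_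
  rw [coe_weylLong_mul_glTransposeInv_mul_weylLong_apply, ← map_inv, GLn.coe_ofFinite_apply,
    GLn.coe_ofFinite_apply, coe_weylLong_mul_glTransposeInv_mul_weylLong_apply, Matrix.one_apply,
    Matrix.one_apply]
  by_cases hij : i = j
  · subst hij
    rw [if_pos rfl, if_pos rfl]
  · rw [if_neg hij, if_neg (fun h' => hij (Fin.rev_injective h').symm)]

/-- `τ` preserves the subgroup `GL_n(𝔸_K^∞) ≤ GL_n(𝔸_K)` of finite-adelic points. [folklore] -/
theorem weylLong_mul_glTransposeInv_mul_weylLong_mem_range_ofFinite {g : GL (Fin n) (AdeleRing (𝓞 K) K)}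
    (hg : g ∈ (GLn.ofFinite n K).range) :
    weylLong n (AdeleRing (𝓞 K) K) * glTransposeInv (Fin n) (AdeleRing (𝓞 K) K) g *
      weylLong n (AdeleRing (𝓞 K) K) ∈ (GLn.ofFinite n K).range := by
  obtain ⟨h, rfl⟩ := hg
  exact ⟨_, (weylLong_mul_glTransposeInv_mul_weylLong_ofFinite h).symm⟩

/-- `τ` commutes with the embedding `GL_n(K_∞) → GL_n(𝔸_K)`, `g ↦ (g, 1)`. [folklore] -/
theorem weylLong_mul_glTransposeInv_mul_weylLong_ofInfinite (g : GL (Fin n) (mixedEmbedding.mixedSpace K)) :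
    weylLong n (AdeleRing (𝓞 K) K) * glTransposeInv (Fin n) (AdeleRing (𝓞 K) K) (GLn.ofInfinite n K g) *
        weylLong n (AdeleRing (𝓞 K) K) =
      GLn.ofInfinite n K (weylLong n (mixedEmbedding.mixedSpace K) *
        glTransposeInv (Fin n) (mixedEmbedding.mixedSpace K) g *
          weylLong n (mixedEmbedding.mixedSpace K)) := by
  refine Matrix.GeneralLinearGroup.ext fun i j => ?_
  rw [coe_weylLong_mul_glTransposeInv_mul_weylLong_apply, ← map_inv, GLn.coe_ofInfinite_apply,
    GLn.coe_ofInfinite_apply, coe_weylLong_mul_glTransposeInv_mul_weylLong_apply, Matrix.one_apply,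
    Matrix.one_apply]
  by_cases hij : i = j
  · subst hij
    rw [if_pos rfl, if_pos rfl]
  · rw [if_neg hij, if_neg (fun h' => hij (Fin.rev_injective h').symm)]

/-- Entries of `GLn.toMixed g`: the archimedean components of the entries of `g`, read in
`K_∞ ≅ ℝ^{r₁} × ℂ^{r₂}` (definitional; private copy of the lemma of the same name in
`AutomorphicRepsGLCuspFormsRapidDecayMWScaling`, not imported here). [folklore] -/
private theorem coe_toMixed_apply_aux (g : GL (Fin n) (AdeleRing (𝓞 K) K)) (i j : Fin n) :
    ((GLn.toMixed n K g : GL (Fin n) (mixedEmbedding.mixedSpace K)) :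
        Matrix (Fin n) (Fin n) (mixedEmbedding.mixedSpace K)) i j =
      InfiniteAdeleRing.ringEquiv_mixedSpace K ((g : Matrix (Fin n) (Fin n) (AdeleRing (𝓞 K) K)) i j).1 :=
  rfl

/-- `τ` commutes with `GLn.toMixed : GL_n(𝔸_K) → GL_n(K_∞)`. [folklore] -/
theorem toMixed_weylLong_mul_glTransposeInv_mul_weylLong (g : GL (Fin n) (AdeleRing (𝓞 K) K)) :
    GLn.toMixed n K (weylLong n (AdeleRing (𝓞 K) K) * glTransposeInv (Fin n) (AdeleRing (𝓞 K) K) g *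
        weylLong n (AdeleRing (𝓞 K) K)) =
      weylLong n (mixedEmbedding.mixedSpace K) *
        glTransposeInv (Fin n) (mixedEmbedding.mixedSpace K) (GLn.toMixed n K g) *
          weylLong n (mixedEmbedding.mixedSpace K) := by
  refine Matrix.GeneralLinearGroup.ext fun i j => ?_
  rw [coe_toMixed_apply_aux, coe_weylLong_mul_glTransposeInv_mul_weylLong_apply,
    coe_weylLong_mul_glTransposeInv_mul_weylLong_apply, ← map_inv, coe_toMixed_apply_aux]

/-- `τ` preserves the arithmetic subgroup `GL_n(K) ≤ GL_n(𝔸_K)`. [folklore] -/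
theorem weylLong_mul_glTransposeInv_mul_weylLong_mem_arithmeticSubgroup
    {γ : GL (Fin n) (AdeleRing (𝓞 K) K)} (hγ : γ ∈ (AdelicGroupData.gl n K).arithmeticSubgroup) :
    weylLong n (AdeleRing (𝓞 K) K) * glTransposeInv (Fin n) (AdeleRing (𝓞 K) K) γ *
      weylLong n (AdeleRing (𝓞 K) K) ∈ (AdelicGroupData.gl n K).arithmeticSubgroup := by
  obtain ⟨γ₀, rfl⟩ := hγ
  letI : TopologicalSpace K := ⊥
  refine ⟨(weylLong n K * glTransposeInv (Fin n) K γ₀ * weylLong n K : GL (Fin n) K), ?_⟩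
  change Matrix.GeneralLinearGroup.map (algebraMap K (AdeleRing (𝓞 K) K))
    (weylLong n K * glTransposeInv (Fin n) K γ₀ * weylLong n K) = _
  rw [map_weylLong_mul_glTransposeInv_mul_weylLong]
  rfl

/-- `τ` preserves `GL_n(𝒪̂_K) ≤ GL_n(𝔸_K^∞)` (entries of `τ(h)`, `τ(h)⁻¹` are entries of `h⁻¹`,
`h`). [folklore] -/
theorem weylLong_mul_glTransposeInv_mul_weylLong_mem_glFiniteIntegralLevel
    {h : GL (Fin n) (FiniteAdeleRing (𝓞 K) K)} (hh : h ∈ glFiniteIntegralLevel n K) :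
    weylLong n (FiniteAdeleRing (𝓞 K) K) * glTransposeInv (Fin n) (FiniteAdeleRing (𝓞 K) K) h *
      weylLong n (FiniteAdeleRing (𝓞 K) K) ∈ glFiniteIntegralLevel n K := by
  rw [mem_glFiniteIntegralLevel_iff] at hh ⊢
  refine ⟨fun i j => ?_, fun i j => ?_⟩
  · rw [coe_weylLong_mul_glTransposeInv_mul_weylLong_apply]
    exact hh.2 _ _
  · rw [coe_inv_weylLong_mul_glTransposeInv_mul_weylLong_apply]
    exact hh.1 _ _

/-- `τ` preserves the integral level `K^max = {1} × GL_n(𝒪̂_K) ≤ GL_n(𝔸_K)`. [folklore] -/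
theorem weylLong_mul_glTransposeInv_mul_weylLong_mem_glIntegralLevel
    {g : GL (Fin n) (AdeleRing (𝓞 K) K)} (hg : g ∈ glIntegralLevel n K) :
    weylLong n (AdeleRing (𝓞 K) K) * glTransposeInv (Fin n) (AdeleRing (𝓞 K) K) g *
      weylLong n (AdeleRing (𝓞 K) K) ∈ glIntegralLevel n K := by
  rw [mem_glIntegralLevel_iff] at hg ⊢
  refine ⟨?_, ?_⟩
  · change Matrix.GeneralLinearGroup.map _ _ ∈ _
    rw [map_weylLong_mul_glTransposeInv_mul_weylLong]
    exact weylLong_mul_glTransposeInv_mul_weylLong_mem_glFiniteIntegralLevel hg.1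
  · change Matrix.GeneralLinearGroup.map _ _ = 1
    rw [map_weylLong_mul_glTransposeInv_mul_weylLong]
    change weylLong n _ * glTransposeInv (Fin n) _ (GLn.fstHom n K g) * weylLong n _ = 1
    rw [hg.2, weylLong_mul_glTransposeInv_mul_weylLong_one]

/-- `τ` preserves the principal congruence subgroups `K(𝔫) ≤ GL_n(𝔸_K)`. [folklore] -/
theorem weylLong_mul_glTransposeInv_mul_weylLong_mem_principalCongruenceLevel {𝔫 : Ideal (𝓞 K)}
    {g : GL (Fin n) (AdeleRing (𝓞 K) K)} (hg : g ∈ principalCongruenceLevel n K 𝔫) :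
    weylLong n (AdeleRing (𝓞 K) K) * glTransposeInv (Fin n) (AdeleRing (𝓞 K) K) g *
      weylLong n (AdeleRing (𝓞 K) K) ∈ principalCongruenceLevel n K 𝔫 := by
  rw [mem_principalCongruenceLevel_iff] at hg ⊢
  refine ⟨weylLong_mul_glTransposeInv_mul_weylLong_mem_glIntegralLevel hg.1, fun v => ?_⟩
  have h2 : Matrix.GeneralLinearGroup.map (AdelicGroupData.adeleEval K v) g ∈
      valuedCongruenceSubgroup (Fin n) (idealRadius K v 𝔫) := hg.2 v
  change Matrix.GeneralLinearGroup.map (AdelicGroupData.adeleEval K v)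
    (weylLong n (AdeleRing (𝓞 K) K) * glTransposeInv (Fin n) (AdeleRing (𝓞 K) K) g *
      weylLong n (AdeleRing (𝓞 K) K)) ∈ valuedCongruenceSubgroup (Fin n) (idealRadius K v 𝔫)
  rw [map_weylLong_mul_glTransposeInv_mul_weylLong]
  exact weylLong_mul_glTransposeInv_mul_weylLong_mem_valuedCongruenceSubgroup h2

/-- Membership in `K(𝔫)` is invariant under `τ`. [folklore] -/
theorem weylLong_mul_glTransposeInv_mul_weylLong_mem_principalCongruenceLevel_iff {𝔫 : Ideal (𝓞 K)}
    (g : GL (Fin n) (AdeleRing (𝓞 K) K)) :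
    weylLong n (AdeleRing (𝓞 K) K) * glTransposeInv (Fin n) (AdeleRing (𝓞 K) K) g *
      weylLong n (AdeleRing (𝓞 K) K) ∈ principalCongruenceLevel n K 𝔫 ↔
        g ∈ principalCongruenceLevel n K 𝔫 := by
  refine ⟨fun h => ?_, weylLong_mul_glTransposeInv_mul_weylLong_mem_principalCongruenceLevel⟩
  rw [← weylLong_mul_glTransposeInv_mul_weylLong_involutive g]
  exact weylLong_mul_glTransposeInv_mul_weylLong_mem_principalCongruenceLevel h

/-- **`τ` permutes the levels**: for a level `U = {1} × U₀` (`U₀ ≤ GL_n(𝔸_K^∞)` compact open) the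
subgroup `τ⁻¹(U) = τ(U)` is again a level. [folklore] -/
theorem exists_mem_finiteLevelsGL_iff_weylLong_mul_glTransposeInv_mul_weylLong_mem
    {U : Subgroup (GL (Fin n) (AdeleRing (𝓞 K) K))} (hU : U ∈ finiteLevelsGL n K) :
    ∃ U' ∈ finiteLevelsGL n K, ∀ u, u ∈ U' ↔
      weylLong n (AdeleRing (𝓞 K) K) * glTransposeInv (Fin n) (AdeleRing (𝓞 K) K) u *
        weylLong n (AdeleRing (𝓞 K) K) ∈ U := by
  obtain ⟨U₀, hU₀o, hU₀c, rfl⟩ := hU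
  -- `τ` on `GL_n(𝔸_K^∞)` as a homomorphism
  let τf : GL (Fin n) (FiniteAdeleRing (𝓞 K) K) →* GL (Fin n) (FiniteAdeleRing (𝓞 K) K) :=
    { toFun := fun h => weylLong n _ * glTransposeInv (Fin n) _ h * weylLong n _
      map_one' := weylLong_mul_glTransposeInv_mul_weylLong_one
      map_mul' := weylLong_mul_glTransposeInv_mul_weylLong_mul }
  have hτf : ∀ h, τf h = weylLong n _ * glTransposeInv (Fin n) _ h * weylLong n _ := fun h => rfl
  have hτfc : Continuous τf := continuous_weylLong_mul_glTransposeInv_mul_weylLong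
  have hmap : (U₀.map τf : Set (GL (Fin n) (FiniteAdeleRing (𝓞 K) K))) = τf ⁻¹' U₀ := by
    ext h
    rw [Subgroup.coe_map, Set.mem_image, Set.mem_preimage, SetLike.mem_coe]
    constructor
    · rintro ⟨h₀, hh₀, rfl⟩
      rw [hτf, hτf, weylLong_mul_glTransposeInv_mul_weylLong_involutive]
      exact hh₀
    · intro hh
      exact ⟨τf h, hh, by rw [hτf, hτf, weylLong_mul_glTransposeInv_mul_weylLong_involutive]⟩
  refine ⟨(U₀.map τf).map (GLn.ofFinite n K), ⟨U₀.map τf, ?_, ?_, rfl⟩, fun u => ?_⟩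
  · rw [hmap]
    exact hU₀o.preimage hτfc
  · rw [Subgroup.coe_map]
    exact hU₀c.image hτfc
  · constructor
    · rintro ⟨_, ⟨h₀, hh₀, rfl⟩, rfl⟩
      refine ⟨h₀, hh₀, ?_⟩
      rw [weylLong_mul_glTransposeInv_mul_weylLong_ofFinite, hτf,
        weylLong_mul_glTransposeInv_mul_weylLong_involutive]
    · rintro ⟨h₁, hh₁, hu₁⟩
      refine ⟨τf h₁, ⟨h₁, hh₁, rfl⟩, ?_⟩
      apply weylLong_mul_glTransposeInv_mul_weylLong_injective
      change weylLong n _ * glTransposeInv (Fin n) _ (GLn.ofFinite n K (τf h₁)) * weylLong n _ =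
        weylLong n _ * glTransposeInv (Fin n) _ u * weylLong n _
      rw [weylLong_mul_glTransposeInv_mul_weylLong_ofFinite, hτf,
        weylLong_mul_glTransposeInv_mul_weylLong_involutive, hu₁]

/-- `τ` preserves the maximal compact subgroup `K_∞ = U(n)` of `GL_n(K_∞)` (it commutes with
`star`). [folklore] -/
theorem weylLong_mul_glTransposeInv_mul_weylLong_mem_Kinf {k : GL (Fin n) (mixedEmbedding.mixedSpace K)}
    (hk : k ∈ Kinf n K) :
    weylLong n (mixedEmbedding.mixedSpace K) * glTransposeInv (Fin n) (mixedEmbedding.mixedSpace K) k *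
      weylLong n (mixedEmbedding.mixedSpace K) ∈ Kinf n K := by
  rw [Kinf_eq_unitarySubgroupGL, mem_unitarySubgroupGL_iff] at hk ⊢
  have hk' : star k * k = 1 := Units.ext (by rw [Units.val_mul, Units.coe_star, hk, Units.val_one])
  rw [← Units.coe_star, ← weylLong_mul_glTransposeInv_mul_weylLong_star, ← Units.val_mul,
    ← weylLong_mul_glTransposeInv_mul_weylLong_mul, hk', weylLong_mul_glTransposeInv_mul_weylLong_one,
    Units.val_one]

/-- The archimedean local height is `τ`-invariant: `H_∞(τ g) = H_∞(g)`. [folklore] -/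
theorem archHeight_weylLong_mul_glTransposeInv_mul_weylLong (g : GL (Fin n) (AdeleRing (𝓞 K) K)) :
    GLn.archHeight n K (weylLong n (AdeleRing (𝓞 K) K) * glTransposeInv (Fin n) (AdeleRing (𝓞 K) K) g *
      weylLong n (AdeleRing (𝓞 K) K)) = GLn.archHeight n K g := by
  unfold GLn.archHeight
  rw [toMixed_weylLong_mul_glTransposeInv_mul_weylLong]
  set h := GLn.toMixed n K g
  let e : Fin n × Fin n ≃ Fin n × Fin n :=
    (Equiv.prodComm _ _).trans (Equiv.prodCongr Fin.revPerm Fin.revPerm)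
  conv_rhs => rw [← Finset.map_univ_equiv e, Finset.sup_map]
  refine Finset.sup_congr rfl fun ij _ => ?_
  rw [Function.comp_apply, Equiv.coe_toEmbedding, coe_weylLong_mul_glTransposeInv_mul_weylLong_apply,
    coe_inv_weylLong_mul_glTransposeInv_mul_weylLong_apply, max_comm]
  rfl

/-- The local heights at finite places are `τ`-invariant: `H_v(τ g) = H_v(g)`. [folklore] -/
theorem localHeight_weylLong_mul_glTransposeInv_mul_weylLong (v : HeightOneSpectrum (𝓞 K))
    (g : GL (Fin n) (AdeleRing (𝓞 K) K)) :
    GLn.localHeight n K v (weylLong n (AdeleRing (𝓞 K) K) *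
      glTransposeInv (Fin n) (AdeleRing (𝓞 K) K) g * weylLong n (AdeleRing (𝓞 K) K)) =
        GLn.localHeight n K v g := by
  unfold GLn.localHeight
  rw [map_weylLong_mul_glTransposeInv_mul_weylLong]
  set h := Matrix.GeneralLinearGroup.map (AdelicGroupData.adeleEval K v) g
  let e : Fin n × Fin n ≃ Fin n × Fin n :=
    (Equiv.prodComm _ _).trans (Equiv.prodCongr Fin.revPerm Fin.revPerm)
  conv_rhs => rw [← Finset.map_univ_equiv e, Finset.sup_map]
  refine Finset.sup_congr rfl fun ij _ => ?_
  rw [Function.comp_apply, Equiv.coe_toEmbedding, coe_weylLong_mul_glTransposeInv_mul_weylLong_apply,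
    coe_inv_weylLong_mul_glTransposeInv_mul_weylLong_apply, max_comm]
  rfl

/-- **The adelic height is `τ`-invariant**: `‖w₀ ᵗg⁻¹ w₀‖ = ‖g‖` (Borel–Jacquet 1979, §1.2: the
height of `GL_n` is that of the embedding `g ↦ (g, g⁻¹)`, symmetric under `g ↦ ᵗg⁻¹` and under
permutation of coordinates). [folklore] -/
theorem adelicHeightGL_weylLong_mul_glTransposeInv_mul_weylLong (g : GL (Fin n) (AdeleRing (𝓞 K) K)) :
    adelicHeightGL n K (weylLong n (AdeleRing (𝓞 K) K) * glTransposeInv (Fin n) (AdeleRing (𝓞 K) K) g *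
      weylLong n (AdeleRing (𝓞 K) K)) = adelicHeightGL n K g := by
  unfold adelicHeightGL
  rw [archHeight_weylLong_mul_glTransposeInv_mul_weylLong]
  congr 1
  exact finprod_congr fun v => by rw [localHeight_weylLong_mul_glTransposeInv_mul_weylLong]

end Adelic

end Literature.NumberTheory.Automorphic
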